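import Summits.ValiantsHypothesis.ValiantsHypothesis.Theorems.OrderedCountWindowBorder
import Summits.ValiantsHypothesis.ValiantsHypothesis.Theorems.OrderedCountWindowNecessity
import Literature.Computability.AlgebraicComplexity.AndrewsForbes2022Applications
import HarnessLib

/-!
# ValiantsHypothesis / DecompCycle1 — the ordered count window in the border, POLYNOMIAL FACE
# (`per_n ∉` the Andrews–Forbes border class of sums of `t` ordered set-multilinear ABPs)

Companion of `OrderedCountWindowBorder.lean` (workshop `decomp-valiant`, lens 6, generation 29,
CALLED offer O5, stage 2 of 2; references as there).  Stage 1 bounds COEFFICIENT TENSORS over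
`F((ε))` (`two_pow_le_of_border`: an `O(ε)`-approximate sum of `t` ordered set-multilinear ABPs
for `per_n` has total width `≥ 2^{⌊⌊n/2⌋/t⌋}`).  Here the bound is transported to POLYNOMIALS in
the currency of [AndrewsForbes2022, Def 2.1] (`borderClass F 𝒞 = {f | ∃ h ∈ 𝒞, h - f = O(ε)}`),
with the program polynomials `progPoly σ C u v = uᵀ L_0 ⋯ L_{n-1} v` of
`OrderedCountWindowNecessity.lean` taken over `F((ε))`:  `W < 2^{⌊⌊n/2⌋/t⌋} ⟹ per_n ∉
borderClass F {∑_{i<t} progPoly (σ i) (C i) u_i v_i | ∑ w_i ≤ W}` over every field ((B5)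
`perPoly_not_mem_borderClass_sumOrdered`).  MECHANISM: coefficient extraction at the WORD
MONOMIALS `∏_c X_(J c, c)` (`J` = column ↦ row; exponent vectors `∑_c e_(J c, c)` written inline,
no definition): the coefficient of `per_n` there is Nisan's `perWord J` (`coeff_word_perPoly`, from
`perPoly_eq_sum_perWord`, [Nisan1991Noncommutative, §4]) and that of `progPoly σ C u v` is the
transfer-matrix word value at `J ∘ σ` (`coeff_word_progPoly`, from `progPoly_eq_sum`,
[ArvindRaja2016, §3]); a coefficientwise `O(ε)` identity of polynomials is thus an `O(ε)` identity
of coefficient tensors, and stage 1 applies.  HONEST FRAMING as in stage 1 (restricted model, blind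
to `per` vs `det`, every characteristic; nothing on `VP ≠ VNP` or on the open crux `PerNotSmVP`,
stmt 23661).  No new definition, no named fact, no sorry.
-/

namespace Summit.ValiantsHypothesis.ValiantsHypothesis.Theorems.OrderedCountWindow

open Literature.Computability.AlgebraicComplexity Matrix
universe u

section WordMonomials
open MvPolynomial
variable {n : ℕ}

/-- The word monomial `∏_c X_(J c, c)` is the monomial with exponent `∑_c e_(J c, c)`. [folklore] -/
theorem prod_X_word {R : Type*} [CommSemiring R] (J : Fin n → Fin n) :
    (∏ c, X (J c, c) : MvPolynomial (Fin n × Fin n) R) =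
      monomial (∑ c, Finsupp.single (J c, c) 1) 1 := by
  rw [monomial_sum_index, C_1, one_mul]; rfl

/-- The exponent of `X_(r, c)` in the word monomial of `J` is `[J c = r]`. [folklore] -/
theorem word_apply (J : Fin n → Fin n) (rc : Fin n × Fin n) :
    (∑ c, Finsupp.single (J c, c) 1 : (Fin n × Fin n) →₀ ℕ) rc = if J rc.2 = rc.1 then 1 else 0 := by
  classical
  obtain ⟨r, c⟩ := rc
  rw [Finsupp.coe_finsetSum, Finset.sum_apply, Finset.sum_eq_single c]
  · simp [Finsupp.single_apply, Prod.ext_iff]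
  · exact fun c' _ hc' => by simp [Prod.ext_iff, hc']
  · simp

/-- A word is determined by its word monomial. [folklore] -/
theorem word_injective : Function.Injective
    fun J : Fin n → Fin n => (∑ c, Finsupp.single (J c, c) 1 : (Fin n × Fin n) →₀ ℕ) := by
  intro J J' h
  funext c
  have hc := congrArg (fun e : (Fin n × Fin n) →₀ ℕ => e (J c, c)) h
  simp only [word_apply, if_true] at hc
  by_cases h1 : J' c = J c
  exacts [h1.symm, by simp [h1] at hc]

/-- Coefficient extraction at a word monomial from a word expansion. [folklore] -/
theorem coeff_word_sum {R : Type*} [CommSemiring R] (a : (Fin n → Fin n) → R) (J : Fin n → Fin n) :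
    coeff (∑ c, Finsupp.single (J c, c) 1)
      (∑ J' : Fin n → Fin n, MvPolynomial.C (a J') *
        ∏ c, (X (J' c, c) : MvPolynomial (Fin n × Fin n) R)) = a J := by
  classical
  simp_rw [prod_X_word, C_mul_monomial, mul_one, coeff_sum, coeff_monomial]
  rw [Finset.sum_eq_single J]
  · rw [if_pos rfl]
  · intro J' _ hJ'
    rw [if_neg fun h => hJ' (word_injective h)]
  · exact fun h => absurd (Finset.mem_univ J) h

variable {F : Type*} [Field F]

/-- The coefficient of the word monomial of `J` in `per_n` is Nisan's `perWord J`.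
[cite: Nisan1991Noncommutative, §4] -/
theorem coeff_word_perPoly (J : Fin n → Fin n) :
    coeff (∑ c, Finsupp.single (J c, c) 1) (perPoly (Fin n) F) = NisanPermanent.perWord F n J := by
  rw [perPoly_eq_sum_perWord]
  exact coeff_word_sum _ J

/-- The coefficient of the word monomial of `J` in `progPoly σ C u v` is the transfer-matrix word
value at the re-ordered word `J ∘ σ`. [cite: ArvindRaja2016, §3 (ROABPs)] -/
theorem coeff_word_progPoly {w : ℕ} (σ : Equiv.Perm (Fin n))
    (Cm : Fin n → Fin n → Matrix (Fin w) (Fin w) F) (u v : Fin w → F) (J : Fin n → Fin n) :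
    coeff (∑ c, Finsupp.single (J c, c) 1) (progPoly σ Cm u v) =
      u ⬝ᵥ ((List.ofFn fun p => Cm p (J (σ p))).prod *ᵥ v) := by
  classical
  have hre : progPoly σ Cm u v = ∑ J' : Fin n → Fin n,
      MvPolynomial.C (u ⬝ᵥ ((List.ofFn fun p => Cm p (J' (σ p))).prod *ᵥ v)) *
        ∏ c, (X (J' c, c) : MvPolynomial (Fin n × Fin n) F) := by
    rw [progPoly_eq_sum]
    let e : (Fin n → Fin n) ≃ (Fin n → Fin n) :=
      { toFun := fun J' => J' ∘ ⇑σ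
        invFun := fun K => K ∘ ⇑σ.symm
        left_inv := fun J' => by ext c; simp
        right_inv := fun K => by ext c; simp }
    symm
    calc ∑ J' : Fin n → Fin n, MvPolynomial.C (u ⬝ᵥ ((List.ofFn fun p => Cm p (J' (σ p))).prod *ᵥ v)) *
          ∏ c, (X (J' c, c) : MvPolynomial (Fin n × Fin n) F)
        = ∑ J' : Fin n → Fin n, (fun K : Fin n → Fin n =>
            MvPolynomial.C (u ⬝ᵥ ((List.ofFn fun p => Cm p (K p)).prod *ᵥ v)) *
              ∏ p, (X (K p, σ p) : MvPolynomial (Fin n × Fin n) F)) (e J') := by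
          refine Finset.sum_congr rfl fun J' _ => ?_
          show _ = MvPolynomial.C (u ⬝ᵥ ((List.ofFn fun p => Cm p ((J' ∘ ⇑σ) p)).prod *ᵥ v)) *
            ∏ p, (X ((J' ∘ ⇑σ) p, σ p) : MvPolynomial (Fin n × Fin n) F)
          rw [← Equiv.prod_comp σ (fun c => (X (J' c, c) : MvPolynomial (Fin n × Fin n) F))]
          rfl
      _ = ∑ K : Fin n → Fin n, MvPolynomial.C (u ⬝ᵥ ((List.ofFn fun p => Cm p (K p)).prod *ᵥ v)) *
            ∏ p, (X (K p, σ p) : MvPolynomial (Fin n × Fin n) F) :=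
          Equiv.sum_comp e (fun K : Fin n → Fin n =>
            MvPolynomial.C (u ⬝ᵥ ((List.ofFn fun p => Cm p (K p)).prod *ᵥ v)) *
              ∏ p, (X (K p, σ p) : MvPolynomial (Fin n × Fin n) F))
  rw [hre]
  exact coeff_word_sum (fun J' => u ⬝ᵥ ((List.ofFn fun p => Cm p (J' (σ p))).prod *ᵥ v)) J

end WordMonomials
/-- **(B5) `per_n ∉` the BORDER CLASS of sums of `t` ordered set-multilinear ABPs of total width
`W < 2^{⌊⌊n/2⌋/t⌋}`** (`borderClass`; programs `progPoly` over `F((ε))`; coefficient extraction,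
then `two_pow_le_of_border`). [cite: ArvindRaja2016, Cor 12; AndrewsForbes2022, Def 2.1, Lemma 6.2] -/
theorem perPoly_not_mem_borderClass_sumOrdered (F : Type u) [Field F] (n t W : ℕ)
    (hW : W < 2 ^ (n / 2 / t)) :
    perPoly (Fin n) F ∉ borderClass F
      {h : MvPolynomial (Fin n × Fin n) (LaurentSeries F) |
        ∃ (w : Fin t → ℕ) (σ : Fin t → Equiv.Perm (Fin n))
          (C : (i : Fin t) → Fin n → Fin n → Matrix (Fin (w i)) (Fin (w i)) (LaurentSeries F))
          (uv : (i : Fin t) → (Fin (w i) → LaurentSeries F) × (Fin (w i) → LaurentSeries F)),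
          ∑ i, w i ≤ W ∧ h = ∑ i, progPoly (σ i) (C i) (uv i).1 (uv i).2} := by
  classical
  rintro ⟨h, ⟨w, σ, Cm, uv, hsum, rfl⟩, hord⟩
  have hB : ∀ i, BDI2020.HasNcABPWidthLE (w i)
      (fun K : Fin n → Fin n => (uv i).1 ⬝ᵥ ((List.ofFn fun p => Cm i p (K p)).prod *ᵥ (uv i).2)) :=
    fun i => ⟨Cm i, (uv i).1, (uv i).2, fun K => rfl⟩
  have hbor : ∀ J : Fin n → Fin n, IsOrdGE 1
      (∑ i, (fun K : Fin n → Fin n =>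
          (uv i).1 ⬝ᵥ ((List.ofFn fun p => Cm i p (K p)).prod *ᵥ (uv i).2)) (J ∘ ⇑(σ i)) -
        algebraMap F (LaurentSeries F) (NisanPermanent.perWord F n J)) := by
    intro J
    have hJ := hord (∑ c, Finsupp.single (J c, c) 1)
    rw [MvPolynomial.coeff_sub, MvPolynomial.coeff_map, MvPolynomial.coeff_sum,
      coeff_word_perPoly] at hJ
    simp only [coeff_word_progPoly] at hJ
    exact hJ
  exact absurd (two_pow_le_of_border F n t W σ w _ hB hsum hbor) (not_le.2 hW)

end Summit.ValiantsHypothesis.ValiantsHypothesis.Theorems.OrderedCountWindow
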